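import Summits.ValiantsHypothesis.ValiantsHypothesis.Theorems.BarrierLeverAnchoredDoorHitsLowerPairsThinStepKill

/-!
# Support item `AnchoredDoorHitsLowerPairs` (stmt-ValiantsHypothesis-22510), line `anchored-peeling`:
# THIN VERTEX STEP, part 2 — the designed `T`-specialisation and the entries of the specialised layout

Helper file towards the registered open stub `stub_vertexStep` of the skeleton
`Cruxes/AnchoredDoorHitsLowerPairs/Lines/anchored_peeling.lean` (v5; planner valiant-natproofs-p1 g19, D-0145; lane val-np-p2).
Cell valiant-natproofs, rung V4, 𝒟-side door (c); prover seat val-np-p2 gen 11. Closes NO item (`--supports stmt-ValiantsHypothesis-22510`).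

THE MECHANISM (seat memo HOME/val-np-p2/g11/THIN-STEP-valnp2-g11.md). Fix an `x`-vertex `a` and a DESIGN: a set `D` of `y`-vertices and,
for each `c ∈ D`, an `x`-face `Sx c ∌ a` (the link face of the row `Sx c ∪ {a}` served by the anchor `(a | c)`) and a `y`-face `τ c`
(the column where that row is to have its top degree). The ring map `thinHom : ℂ[θ, φ, ψ] → ℂ[θ, φ, ψ][T]` (`thinSpec`) sends, for the
DESIGN anchors `(a | c)`, `c ∈ D`: `θ ↦ T^{N (h − |Sx c|)}`, `φ_b ↦ T^{2N}` (`b ∈ Sx c`) / `0`, `ψ_d ↦ T` (`d ∈ τ c ∖ c`) / `0`; kills every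
other anchor whose `x`-part contains `a` (`θ ↦ 0`) and every twist ONTO `x_a`; and keeps all remaining parameters as constants. Then
* `map_thinHom_symbolicWitness`: the specialised witness is `C(F₀) · ∏_{c ∈ D} (1 + x_a · gg c)` with `F₀ = symbolicWitness` with `x_a`
  killed (part 1) and `gg c = Σ_{Z ⊆ Sx c, W ⊆ τ c ∖ c} T^{N(h−|Sx c|) + 2N|Z| + |W|} · x^Z y^{c ∪ W}`;
* `coeff_map_thinHom_of_not_mem` (DELETION ROWS, `a ∉ U`): the entry `[x^U y^W']` is the constant `[x^U y^W'] symbolicWitness`;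
* `coeff_map_thinHom_of_mem` (LINK ROWS, `a ∈ U`): the entry is
  `Σ_{c ∈ D} Σ_{Z ⊆ Sx c} Σ_{W ⊆ τ c ∖ c} [Z ⊆ U ∖ a][c ∪ W ⊆ W'] · T^{N(h−|Sx c|)+2N|Z|+|W|} · [x^{(U∖a)∖Z} y^{W'∖(c∪W)}] F₀`.
Part 3 reads off degrees and top coefficients; part 4 is the thin vertex step itself.

WHAT THIS IS NOT: no statement about items 22510 / 19717 themselves; nothing on crux stmt-ValiantsHypothesis-14610 or on `VP` versus `VNP`.
-/

set_option linter.dupNamespace false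

namespace Summit.ValiantsHypothesis.ValiantsHypothesis.Theorems.BarrierLever.AnchoredPeeling

open Finset MvPolynomial
open Summit.ValiantsHypothesis.ValiantsHypothesis.Theorems.BarrierLever.BrickCalculus
  (pexpo pexpo_def pexpo_le_iff pexpo_sub pexpo_apply_castAdd pexpo_apply_natAdd)

noncomputable section

namespace ThinStep

variable {h : ℕ}

/-! ## 1. The design and the specialisation map -/

/-- Design anchors: `α = ({a}, {c})` with `c ∈ D`. -/
def isDes (a : Fin h) (D : Finset (Fin h)) (α : Finset (Fin h) × Finset (Fin h)) : Bool :=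
  decide (α.1 = {a} ∧ ∃ c ∈ D, α.2 = {c})

/-- Design anchors are exactly the pairs `({a}, {c})`, `c ∈ D`. -/
theorem isDes_iff {a : Fin h} {D : Finset (Fin h)} {α : Finset (Fin h) × Finset (Fin h)} :
    isDes a D α = true ↔ ∃ c ∈ D, α = ({a}, {c}) := by
  simp only [isDes, decide_eq_true_eq]
  constructor
  · rintro ⟨h1, c, hc, h2⟩
    exact ⟨c, hc, Prod.ext h1 h2⟩
  · rintro ⟨c, hc, rfl⟩
    exact ⟨rfl, c, hc, rfl⟩

/-- `({a}, {c})` is a design anchor for `c ∈ D`. -/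
theorem isDes_pair {a c : Fin h} {D : Finset (Fin h)} (hc : c ∈ D) : isDes a D ({a}, {c}) = true :=
  isDes_iff.mpr ⟨c, hc, rfl⟩

/-- Non-design anchors. -/
theorem isDes_eq_false {a : Fin h} {D : Finset (Fin h)} {α : Finset (Fin h) × Finset (Fin h)}
    (hα : ¬ ∃ c ∈ D, α = ({a}, {c})) : isDes a D α = false := by
  rw [← Bool.not_eq_true, isDes_iff]; exact hα

/-- The link face attached to a design anchor (`= Sx c` for `α = ({a},{c})`). -/
def desS (Sx : Fin h → Finset (Fin h)) (α : Finset (Fin h) × Finset (Fin h)) : Finset (Fin h) := α.2.biUnion Sx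

/-- The scaled `y`-twist set attached to a design anchor (`= τ c ∖ c` for `α = ({a},{c})`). -/
def desT (τ : Fin h → Finset (Fin h)) (α : Finset (Fin h) × Finset (Fin h)) : Finset (Fin h) := α.2.biUnion τ \ α.2

/-- The link face of `({a}, {c})` is `Sx c`. -/
theorem desS_pair (Sx : Fin h → Finset (Fin h)) (a c : Fin h) : desS Sx ({a}, {c}) = Sx c := by
  rw [desS, Finset.singleton_biUnion]

/-- The scaled `y`-twist set of `({a}, {c})` is `τ c ∖ c`. -/
theorem desT_pair (τ : Fin h → Finset (Fin h)) (a c : Fin h) : desT τ ({a}, {c}) = (τ c).erase c := by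
  rw [desT, Finset.singleton_biUnion, Finset.sdiff_singleton_eq_erase]

/-- The designed specialisation of the parameters (scale `N`). -/
def thinSpec (a : Fin h) (D : Finset (Fin h)) (Sx τ : Fin h → Finset (Fin h)) (N : ℕ) :
    Param h → Polynomial (MvPolynomial (Param h) ℂ)
  | Sum.inl α =>
      if isDes a D α then Polynomial.X ^ (N * (h - (desS Sx α).card))
      else if a ∈ α.1 then 0 else Polynomial.C (X (Sum.inl α))
  | Sum.inr (Sum.inl (α, b)) =>
      if isDes a D α then (if b ∈ desS Sx α then Polynomial.X ^ (2 * N) else 0)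
      else if b = a then 0 else Polynomial.C (X (Sum.inr (Sum.inl (α, b))))
  | Sum.inr (Sum.inr (α, d)) =>
      if isDes a D α then (if d ∈ desT τ α then Polynomial.X else 0)
      else Polynomial.C (X (Sum.inr (Sum.inr (α, d))))

/-- The specialisation as a ring map. -/
def thinHom (a : Fin h) (D : Finset (Fin h)) (Sx τ : Fin h → Finset (Fin h)) (N : ℕ) :
    MvPolynomial (Param h) ℂ →+* Polynomial (MvPolynomial (Param h) ℂ) :=
  (aeval (thinSpec a D Sx τ N)).toRingHom

/-- The specialisation on a parameter variable. -/
theorem thinHom_X (a : Fin h) (D : Finset (Fin h)) (Sx τ : Fin h → Finset (Fin h)) (N : ℕ) (v : Param h) :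
    thinHom a D Sx τ N (X v) = thinSpec a D Sx τ N v := by
  rw [thinHom, AlgHom.toRingHom_eq_coe, RingHom.coe_coe, aeval_X]

/-- The designed polynomial of the vertex `c`: `gg c = Σ_{Z ⊆ Sx c, W ⊆ τ c ∖ c} T^{N(h−|Sx c|)+2N|Z|+|W|} x^Z y^{c ∪ W}`. -/
def gg (Sx τ : Fin h → Finset (Fin h)) (N : ℕ) (c : Fin h) :
    MvPolynomial (Fin (h + h)) (Polynomial (MvPolynomial (Param h) ℂ)) :=
  ∑ Z ∈ (Sx c).powerset, ∑ W ∈ ((τ c).erase c).powerset,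
    C (Polynomial.X ^ (N * (h - (Sx c).card) + 2 * N * Z.card + W.card)) * monomial (pexpo Z (insert c W)) 1

/-! ## 2. The specialised anchor factors -/

variable (a : Fin h) (D : Finset (Fin h)) (Sx τ : Fin h → Finset (Fin h)) (N : ℕ)

/-- A scaled twist product with an arbitrary scaling polynomial `t`. -/
theorem prod_twist_spec' {A P : Finset (Fin h)} (hP : P ⊆ univ \ A) (t : Polynomial (MvPolynomial (Param h) ℂ))
    (e : Fin h → Fin (h + h)) :
    (∏ b ∈ univ \ A, (1 + C (if b ∈ P then t else 0) * X (e b)) :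
        MvPolynomial (Fin (h + h)) (Polynomial (MvPolynomial (Param h) ℂ))) =
      ∏ b ∈ P, (1 + C t * X (e b)) := by
  rw [← Finset.prod_subset hP (fun b _ hbP => by rw [if_neg hbP, map_zero, zero_mul, add_zero])]
  exact Finset.prod_congr rfl (fun b hb => by rw [if_pos hb])

/-- The design anchor's weight under the specialisation. -/
theorem thinHom_theta_des {c : Fin h} (hc : c ∈ D) :
    thinHom a D Sx τ N (X (Sum.inl ({a}, {c}))) = Polynomial.X ^ (N * (h - (Sx c).card)) := by
  rw [thinHom_X, thinSpec, isDes_pair hc, desS_pair]; rfl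

/-- The design anchor's `x`-twists under the specialisation. -/
theorem thinHom_phi_des {c : Fin h} (hc : c ∈ D) (b : Fin h) :
    thinHom a D Sx τ N (X (Sum.inr (Sum.inl (({a}, {c}), b)))) = if b ∈ Sx c then Polynomial.X ^ (2 * N) else 0 := by
  rw [thinHom_X, thinSpec, isDes_pair hc, desS_pair]; rfl

/-- The design anchor's `y`-twists under the specialisation. -/
theorem thinHom_psi_des {c : Fin h} (hc : c ∈ D) (d : Fin h) :
    thinHom a D Sx τ N (X (Sum.inr (Sum.inr (({a}, {c}), d)))) = if d ∈ (τ c).erase c then Polynomial.X else 0 := by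
  rw [thinHom_X, thinSpec, isDes_pair hc, desT_pair]; rfl

/-- **Design factor**: `map thinHom (symbFactor ({a},{c})) = 1 + x_a · gg c` (`c ∈ D`, `a ∉ Sx c`). -/
theorem map_thinHom_symbFactor_des {c : Fin h} (hc : c ∈ D) (haS : a ∉ Sx c) :
    MvPolynomial.map (thinHom a D Sx τ N) (symbFactor h ({a}, {c})) = 1 + X (Fin.castAdd h a) * gg Sx τ N c := by
  classical
  have hP : Sx c ⊆ univ \ ({a} : Finset (Fin h)) := fun b hb =>
    Finset.mem_sdiff.mpr ⟨Finset.mem_univ _, fun hba => haS (Finset.mem_singleton.mp hba ▸ hb)⟩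
  have hQ : (τ c).erase c ⊆ univ \ ({c} : Finset (Fin h)) := fun d hd =>
    Finset.mem_sdiff.mpr ⟨Finset.mem_univ _, fun hdc => Finset.ne_of_mem_erase hd (Finset.mem_singleton.mp hdc)⟩
  rw [symbFactor]
  simp only [map_add, map_one, map_mul, map_prod, map_C, map_X, thinHom_theta_des a D Sx τ N hc,
    thinHom_phi_des a D Sx τ N hc, thinHom_psi_des a D Sx τ N hc, Finset.prod_singleton]
  rw [prod_twist_spec' hP, prod_twist_spec' hQ, prod_one_add_C_mul_X, prod_one_add_C_mul_X,
    mul_assoc _ (∑ Z ∈ (Sx c).powerset, _) (∑ W ∈ ((τ c).erase c).powerset, _), Finset.sum_mul_sum, Finset.mul_sum]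
  conv_rhs => rw [gg, Finset.mul_sum]
  refine congrArg (HAdd.hAdd (1 : MvPolynomial (Fin (h + h)) (Polynomial (MvPolynomial (Param h) ℂ)))) ?_
  refine Finset.sum_congr rfl (fun Z _ => ?_)
  rw [Finset.mul_sum, Finset.mul_sum]
  refine Finset.sum_congr rfl (fun W hW => ?_)
  have hcW : c ∉ W := fun hcW => Finset.notMem_erase c (τ c) (Finset.mem_powerset.mp hW hcW)
  have hmono : (monomial (pexpo Z (insert c W)) (1 : Polynomial (MvPolynomial (Param h) ℂ)) :
      MvPolynomial (Fin (h + h)) (Polynomial (MvPolynomial (Param h) ℂ))) =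
      (∏ b ∈ Z, X (Fin.castAdd h b)) * (X (Fin.natAdd h c) * ∏ d ∈ W, X (Fin.natAdd h d)) := by
    rw [← Finset.prod_insert hcW
        (f := fun d => (X (Fin.natAdd h d) : MvPolynomial (Fin (h + h)) (Polynomial (MvPolynomial (Param h) ℂ)))),
      prod_X_eq_monomial', prod_X_eq_monomial', monomial_mul, mul_one, pexpo_def]
  rw [hmono]
  calc _ = (C (Polynomial.X ^ (N * (h - (Sx c).card))) * C ((Polynomial.X ^ (2 * N)) ^ Z.card) *
        C (Polynomial.X ^ W.card)) * (X (Fin.castAdd h a) *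
        ((∏ b ∈ Z, X (Fin.castAdd h b)) * (X (Fin.natAdd h c) * ∏ d ∈ W, X (Fin.natAdd h d)))) := by ring
    _ = _ := by rw [← map_mul, ← map_mul, ← pow_mul, ← pow_add, ← pow_add, ← mul_assoc]; ring

/-- **Killed `a`-anchor**: a non-design anchor whose `x`-part contains `a` maps to `1`. -/
theorem map_thinHom_symbFactor_kill {α : Finset (Fin h) × Finset (Fin h)} (hdes : ¬ ∃ c ∈ D, α = ({a}, {c}))
    (ha : a ∈ α.1) : MvPolynomial.map (thinHom a D Sx τ N) (symbFactor h α) = 1 := by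
  rw [symbFactor]
  simp only [map_add, map_one, map_mul, map_C, thinHom_X, thinSpec, isDes_eq_false hdes, if_pos ha]
  simp

/-- **Constant anchor**: an anchor with `a ∉ A` maps to the constant image of its `x_a`-free factor. -/
theorem map_thinHom_symbFactor_const {α : Finset (Fin h) × Finset (Fin h)} (ha : a ∉ α.1) :
    MvPolynomial.map (thinHom a D Sx τ N) (symbFactor h α) = MvPolynomial.map Polynomial.C (delFactor a α) := by
  classical
  have hdes : ¬ ∃ c ∈ D, α = ({a}, {c}) := by
    rintro ⟨c, -, rfl⟩
    exact ha (Finset.mem_singleton_self a)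
  have hmem : a ∈ univ \ α.1 := Finset.mem_sdiff.mpr ⟨Finset.mem_univ _, ha⟩
  have h4 : (∏ b ∈ univ \ α.1, (1 + C (thinHom a D Sx τ N (X (Sum.inr (Sum.inl (α, b))))) * X (Fin.castAdd h b)) :
        MvPolynomial (Fin (h + h)) (Polynomial (MvPolynomial (Param h) ℂ))) =
      ∏ b ∈ (univ \ α.1).erase a, (1 + C (Polynomial.C (X (Sum.inr (Sum.inl (α, b))))) * X (Fin.castAdd h b)) := by
    rw [← Finset.mul_prod_erase _ _ hmem, thinHom_X, thinSpec, isDes_eq_false hdes]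
    simp only [Bool.false_eq_true, ↓reduceIte, map_zero, zero_mul, add_zero, one_mul]
    refine Finset.prod_congr rfl (fun b hb => ?_)
    rw [thinHom_X, thinSpec, isDes_eq_false hdes]
    simp only [Bool.false_eq_true, ↓reduceIte, if_neg (Finset.ne_of_mem_erase hb)]
  rw [symbFactor, delFactor]
  simp only [map_add, map_one, map_mul, map_prod, map_C, map_X]
  rw [h4, thinHom_X, thinSpec, isDes_eq_false hdes]
  simp only [Bool.false_eq_true, ↓reduceIte, if_neg ha, thinHom_X, thinSpec, isDes_eq_false hdes]

/-- The design factor attached to an anchor: `1 + x_a · gg c` if `α = ({a},{c})` with `c ∈ D`, and `1` otherwise. -/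
def dfac (α : Finset (Fin h) × Finset (Fin h)) : MvPolynomial (Fin (h + h)) (Polynomial (MvPolynomial (Param h) ℂ)) :=
  ∏ c ∈ D with (({a}, {c}) : Finset (Fin h) × Finset (Fin h)) = α, (1 + X (Fin.castAdd h a) * gg Sx τ N c)

/-- **Every anchor factor specialises to (constant image of its `x_a`-killed factor) × (its design factor).** -/
theorem map_thinHom_symbFactor (hD : ∀ c ∈ D, a ∉ Sx c) (α : Finset (Fin h) × Finset (Fin h)) :
    MvPolynomial.map (thinHom a D Sx τ N) (symbFactor h α) =
      MvPolynomial.map Polynomial.C (killVars {Fin.castAdd h a} (symbFactor h α)) * dfac a D Sx τ N α := by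
  classical
  by_cases hdes : ∃ c ∈ D, α = ({a}, {c})
  · obtain ⟨c, hc, rfl⟩ := hdes
    have hfil : D.filter (fun c' => (({a}, {c'}) : Finset (Fin h) × Finset (Fin h)) = ({a}, {c})) = {c} := by
      ext c'
      simp only [Finset.mem_filter, Finset.mem_singleton, Prod.mk.injEq, true_and, Finset.singleton_inj]
      exact ⟨fun h' => h'.2, fun h' => ⟨h' ▸ hc, h'⟩⟩
    rw [dfac, hfil, Finset.prod_singleton, map_thinHom_symbFactor_des a D Sx τ N hc (hD c hc),
      killVars_symbFactor_of_mem _ _ (Finset.mem_singleton_self a) (Finset.mem_singleton_self _), map_one, one_mul]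
  · have hfil : D.filter (fun c' => (({a}, {c'}) : Finset (Fin h) × Finset (Fin h)) = α) = ∅ := by
      rw [Finset.filter_eq_empty_iff]
      intro c' hc' heq
      exact hdes ⟨c', hc', heq.symm⟩
    rw [dfac, hfil, Finset.prod_empty, mul_one]
    by_cases ha : a ∈ α.1
    · rw [map_thinHom_symbFactor_kill a D Sx τ N hdes ha,
        killVars_symbFactor_of_mem _ _ ha (Finset.mem_singleton_self _), map_one]
    · rw [map_thinHom_symbFactor_const a D Sx τ N ha, killVars_symbFactor_castAdd_of_not_mem a α ha]

/-- **The specialised witness**: `C(F₀) · ∏_{c ∈ D} (1 + x_a · gg c)`, `F₀` = the witness with `x_a` killed (`s ≥ 1`). -/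
theorem map_thinHom_symbolicWitness {s : ℕ} (hs : 1 ≤ s) (hD : ∀ c ∈ D, a ∉ Sx c) :
    MvPolynomial.map (thinHom a D Sx τ N) (symbolicWitness s h) =
      MvPolynomial.map Polynomial.C (killVars {Fin.castAdd h a} (symbolicWitness s h)) *
        ∏ c ∈ D, (1 + X (Fin.castAdd h a) * gg Sx τ N c) := by
  classical
  rw [symbolicWitness_eq_prod, map_prod, map_prod, map_prod,
    Finset.prod_congr rfl (fun α _ => map_thinHom_symbFactor a D Sx τ N hD α), Finset.prod_mul_distrib]
  congr 1
  have hmaps : ∀ c ∈ D, (({a}, {c}) : Finset (Fin h) × Finset (Fin h)) ∈ anchors s h := by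
    intro c _
    simp only [anchors, Finset.mem_filter, Finset.mem_univ, true_and, Finset.card_singleton]
    omega
  simp only [dfac]
  exact Finset.prod_fiberwise_of_maps_to hmaps _

/-! ## 3. Coefficient bookkeeping -/

/-- `[m] (X_v^k · p) = [k ≤ m v] · [m − k e_v] p`. -/
theorem coeff_X_pow_mul' {σ R : Type*} [CommSemiring R] [DecidableEq σ] (m : σ →₀ ℕ) (v : σ) (k : ℕ)
    (p : MvPolynomial σ R) :
    coeff m (X v ^ k * p) = if k ≤ m v then coeff (m - Finsupp.single v k) p else 0 := by
  rw [X_pow_eq_monomial, coeff_monomial_mul']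
  simp only [Finsupp.single_le_iff, one_mul]

/-- A product `∏_{c ∈ D} (1 + X_v · g c)` has the shape `1 + X_v · Σ g + X_v² · Q`. -/
theorem exists_prod_one_add_X_mul {σ R ι : Type*} [CommSemiring R] [DecidableEq ι] (D : Finset ι)
    (g : ι → MvPolynomial σ R) (v : σ) :
    ∃ Q : MvPolynomial σ R, ∏ c ∈ D, (1 + X v * g c) = 1 + X v * ∑ c ∈ D, g c + X v ^ 2 * Q := by
  induction D using Finset.induction_on with
  | empty => exact ⟨0, by simp⟩
  | insert c D hc ih =>
    obtain ⟨Q, hQ⟩ := ih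
    refine ⟨Q + g c * ∑ c' ∈ D, g c' + X v * g c * Q, ?_⟩
    rw [Finset.prod_insert hc, Finset.sum_insert hc, hQ]
    ring

/-- Square-free exponent of a row through `a`: `x^U y^W' = x_a · x^{U ∖ a} y^{W'}`. -/
theorem pexpo_eq_single_add_erase {U : Finset (Fin h)} (W' : Finset (Fin h)) {a : Fin h} (ha : a ∈ U) :
    pexpo U W' = Finsupp.single (Fin.castAdd h a) 1 + pexpo (U.erase a) W' := by
  have h1 : pexpo ({a} : Finset (Fin h)) ∅ = Finsupp.single (Fin.castAdd h a) 1 := by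
    rw [pexpo_def, Finset.sum_singleton, Finset.sum_empty, add_zero]
  rw [← h1, ← pexpo_union (Finset.disjoint_singleton_left.mpr (Finset.notMem_erase a U))
    (Finset.disjoint_empty_left _), ← Finset.insert_eq, Finset.insert_erase ha, Finset.empty_union]

/-- The `x_a`-exponent of a row through `a` is `1`. -/
theorem pexpo_castAdd_of_mem {U : Finset (Fin h)} (W' : Finset (Fin h)) {a : Fin h} (ha : a ∈ U) :
    pexpo U W' (Fin.castAdd h a) = 1 := by
  rw [pexpo_apply_castAdd, if_pos ha]

/-- The `x_a`-exponent of a row avoiding `a` is `0`. -/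
theorem pexpo_castAdd_of_not_mem {U : Finset (Fin h)} (W' : Finset (Fin h)) {a : Fin h} (ha : a ∉ U) :
    pexpo U W' (Fin.castAdd h a) = 0 := by
  rw [pexpo_apply_castAdd, if_neg ha]

/-! ## 4. The entries of the specialised layout matrix -/

/-- **Deletion rows.** For `a ∉ U` the entry `[x^U y^W']` of the specialised witness is the constant `[x^U y^W'] symbolicWitness`. -/
theorem coeff_map_thinHom_of_not_mem {s : ℕ} (hs : 1 ≤ s) (hD : ∀ c ∈ D, a ∉ Sx c) {U : Finset (Fin h)}
    (W' : Finset (Fin h)) (haU : a ∉ U) :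
    coeff (pexpo U W') (MvPolynomial.map (thinHom a D Sx τ N) (symbolicWitness s h)) =
      Polynomial.C (coeff (pexpo U W') (symbolicWitness s h)) := by
  classical
  obtain ⟨Q, hQ⟩ := exists_prod_one_add_X_mul D (gg Sx τ N) (Fin.castAdd h a)
  rw [map_thinHom_symbolicWitness a D Sx τ N hs hD, hQ]
  set F' := MvPolynomial.map Polynomial.C (killVars {Fin.castAdd h a} (symbolicWitness s h)) with hF'
  have hsplit : F' * (1 + X (Fin.castAdd h a) * ∑ c ∈ D, gg Sx τ N c + X (Fin.castAdd h a) ^ 2 * Q) =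
      F' + X (Fin.castAdd h a) * (F' * ∑ c ∈ D, gg Sx τ N c) + X (Fin.castAdd h a) ^ 2 * (F' * Q) := by ring
  rw [hsplit, coeff_add, coeff_add, coeff_X_mul', if_neg, coeff_X_pow_mul', if_neg, add_zero, add_zero, hF', coeff_map,
    coeff_killVars_symbolicWitness_of_not_mem s h a W' haU]
  · rw [pexpo_castAdd_of_not_mem W' haU]; omega
  · rw [Finsupp.mem_support_iff, pexpo_castAdd_of_not_mem W' haU]; exact fun h0 => h0 rfl

/-- **Link rows.** For `a ∈ U` the entry `[x^U y^W']` of the specialised witness is the designed triple sum. -/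
theorem coeff_map_thinHom_of_mem {s : ℕ} (hs : 1 ≤ s) (hD : ∀ c ∈ D, a ∉ Sx c) {U : Finset (Fin h)}
    (W' : Finset (Fin h)) (haU : a ∈ U) :
    coeff (pexpo U W') (MvPolynomial.map (thinHom a D Sx τ N) (symbolicWitness s h)) =
      ∑ c ∈ D, ∑ Z ∈ (Sx c).powerset, ∑ W ∈ ((τ c).erase c).powerset,
        if Z ⊆ U.erase a ∧ insert c W ⊆ W' then
          Polynomial.monomial (N * (h - (Sx c).card) + 2 * N * Z.card + W.card)
            (coeff (pexpo (U.erase a \ Z) (W' \ insert c W)) (killVars {Fin.castAdd h a} (symbolicWitness s h)))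
        else 0 := by
  classical
  obtain ⟨Q, hQ⟩ := exists_prod_one_add_X_mul D (gg Sx τ N) (Fin.castAdd h a)
  rw [map_thinHom_symbolicWitness a D Sx τ N hs hD, hQ]
  set F' := MvPolynomial.map Polynomial.C (killVars {Fin.castAdd h a} (symbolicWitness s h)) with hF'
  have hsplit : F' * (1 + X (Fin.castAdd h a) * ∑ c ∈ D, gg Sx τ N c + X (Fin.castAdd h a) ^ 2 * Q) =
      F' + X (Fin.castAdd h a) * (F' * ∑ c ∈ D, gg Sx τ N c) + X (Fin.castAdd h a) ^ 2 * (F' * Q) := by ring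
  have hzero : coeff (pexpo U W') F' = 0 := by
    rw [hF', coeff_map, coeff_killVars_symbolicWitness_of_mem s h a W' haU, map_zero]
  rw [hsplit, coeff_add, coeff_add, hzero, zero_add, coeff_X_pow_mul', if_neg, add_zero, coeff_X_mul', if_pos,
    pexpo_eq_single_add_erase W' haU, add_tsub_cancel_left, Finset.mul_sum, coeff_sum]
  · refine Finset.sum_congr rfl (fun c _ => ?_)
    rw [gg, Finset.mul_sum, coeff_sum]
    refine Finset.sum_congr rfl (fun Z _ => ?_)
    rw [Finset.mul_sum, coeff_sum]
    refine Finset.sum_congr rfl (fun W _ => ?_)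
    rw [mul_left_comm, coeff_C_mul, coeff_mul_monomial', mul_one]
    by_cases hle : Z ⊆ U.erase a ∧ insert c W ⊆ W'
    · rw [if_pos ((pexpo_le_iff _ _ _ _).mpr hle), if_pos hle, pexpo_sub _ _ _ _ hle.1 hle.2, hF', coeff_map, mul_comm,
        Polynomial.C_mul_X_pow_eq_monomial]
    · rw [if_neg (fun h' => hle ((pexpo_le_iff _ _ _ _).mp h')), if_neg hle, mul_zero]
  · rw [Finsupp.mem_support_iff, pexpo_castAdd_of_mem W' haU]; exact one_ne_zero
  · rw [pexpo_castAdd_of_mem W' haU]; omega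

/-- The specialised layout matrix is the image of the symbolic layout matrix; its determinant is the image of the symbolic minor. -/
theorem det_thinLayout (s h r : ℕ) (u w : Fin r → Finset (Fin h)) (a : Fin h) (D : Finset (Fin h))
    (Sx τ : Fin h → Finset (Fin h)) (N : ℕ) :
    (Matrix.of fun i j : Fin r =>
        coeff (pexpo (u i) (w j)) (MvPolynomial.map (thinHom a D Sx τ N) (symbolicWitness s h))).det =
      thinHom a D Sx τ N (symbolicDet s h r u w) := by
  have h1 : symbolicDet s h r u w =
      (Matrix.of fun i j : Fin r => coeff (pexpo (u i) (w j)) (symbolicWitness s h)).det := rfl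
  have h2 : (Matrix.of fun i j : Fin r =>
      coeff (pexpo (u i) (w j)) (MvPolynomial.map (thinHom a D Sx τ N) (symbolicWitness s h))) =
      (thinHom a D Sx τ N).mapMatrix (Matrix.of fun i j : Fin r => coeff (pexpo (u i) (w j)) (symbolicWitness s h)) := by
    ext i j
    rw [RingHom.mapMatrix_apply, Matrix.map_apply, Matrix.of_apply, Matrix.of_apply, coeff_map]
  rw [h1, RingHom.map_det, h2]

end ThinStep

end

end Summit.ValiantsHypothesis.ValiantsHypothesis.Theorems.BarrierLever.AnchoredPeeling
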